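import Summits.BirchSwinnertonDyer.BirchSwinnertonDyer.Theorems.UniversalToricDescentAcDualMuZeroCriterion
import Summits.BirchSwinnertonDyer.BirchSwinnertonDyer.Theorems.UniversalToricDescentInvariantsTransportNormProfileFrames
import Literature.NumberTheory.EllipticCurves.IwasawaAlgebraCharIdealProofs
import Literature.NumberTheory.EllipticCurves.IwasawaAlgebraStructureProofs
import Mathlib.RingTheory.Polynomial.Eisenstein.Distinguished
import HarnessLib

/-!
# Route UniversalToricDescent — the λ-invariant of a `Λ`-module with `μ = 0` IS the norm profile of any
# generator of `Ch_Λ(M)·R₀⟦T⟧` (the currency of crux #2 `ToricTransportModThree` / child 21845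
# `InvariantsTransportModThreeT`): `λ(M) = n ⟺ ‖g_i‖ < 1 (i < n), ‖g_n‖ = 1`

Lead prover bsd-wall-utd-p1 g6 (`--supports stmt-BirchSwinnertonDyer-20399`). The route states the
Iwasawa invariants of `X = X_ac(E[3^∞])` through a generator `g` of `Ch_Λ(X)·R₀⟦T⟧` and its NORM PROFILE
`(∀ i < n, ‖g_i‖ < 1) ∧ ‖g_n‖ = 1` (so `μ(g) = 0`, `λ(g) = n`), while the algebraic transport
(`UniversalToricDescentLambdaTransport`) speaks of the intrinsic `lambdaInvariant p X = dim_{ℚ_p} ℚ_p ⊗ X`.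
This file identifies the two for every finitely generated torsion `Λ = ℤ_p⟦T⟧`-module `M` with `μ(M) = 0`:
* §1 distinguished polynomials: `1`, products and powers of distinguished polynomials are distinguished
  (Mathlib `Polynomial.IsDistinguishedAt.mul`), with additive degree; a distinguished `Q ∈ ℤ_p[X]` of
  degree `d`, read in `R₀⟦T⟧`, has norm profile `d` (`normProfile_map_coe_of_isDistinguishedAt`; the
  profile index is unique);
* §2 `exists_isDistinguishedAt_charIdeal_eq_span`: by the structure theorem (tree
  `exists_isPseudoIsomorphism_elementary_holds`, `charIdeal_eq_span_holds`, `muInvariant_eq_sum_holds`,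
  `lambdaInvariant_eq_sum_natDegree_holds`), `μ(M) = 0` forces `Ch_Λ(M) = (Q)` with `Q = ∏ f_j^{n_j}`
  distinguished of degree `λ(M)`;
* §3 **`lambdaInvariant_eq_iff_normProfile`**: for ANY generator `g` of `Ch_Λ(M)·R₀⟦T⟧`,
  `λ(M) = n ⟺ profileₙ(g)` (generators are associated, tree `normProfile_iff_of_span_singleton_eq`);
  readings for `X_ac^Σ(E[p^∞])`: `exists_generator_normProfile_lambdaInvariant`,
  `lambdaInvariant_eq_of_generator_normProfile`.
With `UniversalToricDescentLambdaTransport.lambdaInvariant_baseChange_eq_of_modPCongruent` this turns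
«`λ(X_ac^Σ(W_K)) = λ(X_ac^Σ(W′_K))`» into the profile language of 21845 at the `Σ`-imprimitive level.

HONEST STATUS: algebra helper; nothing of 21845's analytic half, of (N1), or of the `Σ → ∅` passage is
touched. THEOREMS ONLY; no definition, no named fact, no `sorry`. BSD is not advanced by this file.
References: [Washington1997] §7.1 (distinguished polynomials), §13.2 (Thm. 13.12, Prop. 13.8, λ and μ of
the characteristic power series); [GreenbergVatsal2000] p. 2 (1)–(2).
-/

set_option autoImplicit false
-- `…BirchSwinnertonDyer.BirchSwinnertonDyer.Theorems…` is the problem's mandated namespace (D-0017).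
set_option linter.dupNamespace false

noncomputable section

open scoped Classical

namespace Summit.BirchSwinnertonDyer.BirchSwinnertonDyer.Theorems.UniversalToricDescentLambdaNormProfile

open Polynomial NumberField IsDedekindDomain Field
open Literature.NumberTheory.EllipticCurves Literature.NumberTheory.EllipticCurves.IwasawaAlgebra
  Summit.BirchSwinnertonDyer.Rank1Residual.X11b Summit.BirchSwinnertonDyer.Rank1Residual.X11b.AcSelmer
  Summit.BirchSwinnertonDyer.BirchSwinnertonDyer.Theorems.UniversalToricDescentAcDualMuZero
  Summit.BirchSwinnertonDyer.BirchSwinnertonDyer.Theorems.UniversalToricDescentNormProfile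

variable {p : ℕ} [hp : Fact p.Prime]

/-! ### §1 Distinguished polynomials and their norm profile in `R₀⟦T⟧` -/

section Distinguished

variable {R : Type*} [CommRing R] {I : Ideal R}

/-- `1` is distinguished (monic of degree `0`; no lower coefficients). [cite: Washington1997, §7.1] -/
theorem isDistinguishedAt_one : (1 : R[X]).IsDistinguishedAt I where
  mem := fun {n} hn ↦ by
    rw [natDegree_one] at hn
    exact (Nat.not_lt_zero n hn).elim
  monic := monic_one

/-- Powers of a distinguished polynomial are distinguished. [cite: Washington1997, §7.1] -/
theorem isDistinguishedAt_pow {f : R[X]} (hf : f.IsDistinguishedAt I) (n : ℕ) :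
    (f ^ n).IsDistinguishedAt I := by
  induction n with
  | zero => rw [pow_zero]; exact isDistinguishedAt_one
  | succ n ih => rw [pow_succ]; exact ih.mul hf

/-- A product `∏ f_j^{n_j}` of powers of distinguished polynomials is distinguished, of degree
`∑ n_j · deg f_j` (over a nontrivial ring). [cite: Washington1997, §7.1] -/
theorem isDistinguishedAt_prod_pow [Nontrivial R] (fs : List (R[X] × ℕ))
    (hfs : ∀ f ∈ fs, f.1.IsDistinguishedAt I) :
    ((fs.map fun f : R[X] × ℕ ↦ f.1 ^ f.2).prod).IsDistinguishedAt I ∧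
      ((fs.map fun f : R[X] × ℕ ↦ f.1 ^ f.2).prod).natDegree =
        (fs.map fun f : R[X] × ℕ ↦ f.2 * f.1.natDegree).sum := by
  induction fs with
  | nil =>
    simp only [List.map_nil, List.prod_nil, List.sum_nil, natDegree_one]
    exact ⟨isDistinguishedAt_one, trivial⟩
  | cons f fs ih =>
    have hf : f.1.IsDistinguishedAt I := hfs f (by simp)
    obtain ⟨ih1, ih2⟩ := ih (fun g hg ↦ hfs g (List.mem_cons_of_mem _ hg))
    have hpow := isDistinguishedAt_pow hf f.2
    simp only [List.map_cons, List.prod_cons, List.sum_cons]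
    refine ⟨hpow.mul ih1, ?_⟩
    rw [hpow.monic.natDegree_mul ih1.monic, ih2, hf.monic.natDegree_pow]

/-- The coercion `ℤ_p[X] → Λ = ℤ_p⟦T⟧` takes `∏ f_j^{n_j}` to the product of the coerced powers (the shape
of the tree's `charElement`). [folklore] -/
theorem coe_prod_pow (fs : List (ℤ_[p][X] × ℕ)) :
    (((fs.map fun f : ℤ_[p][X] × ℕ ↦ f.1 ^ f.2).prod : ℤ_[p][X]) : IwasawaAlgebra p) =
      (fs.map fun f : ℤ_[p][X] × ℕ ↦ (f.1 : IwasawaAlgebra p) ^ f.2).prod := by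
  induction fs with
  | nil => simp
  | cons f fs ih =>
    simp only [List.map_cons, List.prod_cons, Polynomial.coe_mul, Polynomial.coe_pow, ih]

/-- **A distinguished polynomial of degree `d`, read in `R₀⟦T⟧`, has norm profile `d`**: its coefficients
below `d` lie in `pℤ_p` (norm `< 1`), its leading coefficient is `1`; `ℤ_p → R₀` is isometric.
[cite: Washington1997, §7.1] -/
theorem normProfile_map_coe_of_isDistinguishedAt {Q : ℤ_[p][X]}
    (hQ : Q.IsDistinguishedAt (IsLocalRing.maximalIdeal ℤ_[p])) :
    (∀ i < Q.natDegree, ‖((PowerSeries.coeff i (PowerSeries.map (Halves.toUnr p) (Q : IwasawaAlgebra p)) :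
        unrIntegers p) : ℂ_[p])‖ < 1) ∧
      ‖((PowerSeries.coeff Q.natDegree (PowerSeries.map (Halves.toUnr p) (Q : IwasawaAlgebra p)) :
        unrIntegers p) : ℂ_[p])‖ = 1 := by
  refine ⟨fun i hi ↦ ?_, ?_⟩
  · rw [PowerSeries.coeff_map, Polynomial.coeff_coe, norm_coe_toUnr]
    have hmem := hQ.mem hi
    rw [IsLocalRing.mem_maximalIdeal] at hmem
    exact PadicInt.mem_nonunits.mp hmem
  · rw [PowerSeries.coeff_map, Polynomial.coeff_coe, norm_coe_toUnr, hQ.monic.coeff_natDegree, norm_one]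

end Distinguished

/-! ### §2 `μ(M) = 0` ⟹ `Ch_Λ(M) = (Q)` with `Q` distinguished of degree `λ(M)` -/

section Structure

variable (M : Type*) [AddCommGroup M] [Module (IwasawaAlgebra p) M] [Module.Finite (IwasawaAlgebra p) M]

/-- **Structure theorem, `μ = 0` case**: for a finitely generated torsion `Λ`-module `M` with `μ(M) = 0`
there is a distinguished polynomial `Q ∈ ℤ_p[X]` (namely `∏ f_j^{n_j}` for `M ∼ ⊕ Λ/(f_j^{n_j})`) with
`deg Q = λ(M)` and `Ch_Λ(M) = (Q)`. [cite: Washington1997, §13.2 (Thm. 13.12 and Prop. 13.8)] -/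
theorem exists_isDistinguishedAt_charIdeal_eq_span (hM : Module.IsTorsion (IwasawaAlgebra p) M)
    (hμ : muInvariant p M = 0) :
    ∃ Q : ℤ_[p][X], Q.IsDistinguishedAt (IsLocalRing.maximalIdeal ℤ_[p]) ∧
      Q.natDegree = lambdaInvariant p M ∧
      Module.charIdeal (IwasawaAlgebra p) M = Ideal.span {(Q : IwasawaAlgebra p)} := by
  obtain ⟨μs, fs, -, hfs, hψ⟩ := exists_isPseudoIsomorphism_elementary_holds p M hM
  have hfs' : ∀ f ∈ fs, f.1.IsDistinguishedAt (IsLocalRing.maximalIdeal ℤ_[p]) :=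
    fun f hf ↦ (hfs f hf).1
  have hchar : Module.charIdeal (IwasawaAlgebra p) M = Ideal.span {charElement p μs fs} :=
    charIdeal_eq_span_holds p M hfs' hψ
  have hμs : μs.sum = 0 := by rw [← muInvariant_eq_sum_holds p M hfs' hψ, hμ]
  have hlam : lambdaInvariant p M = (fs.map fun f : ℤ_[p][X] × ℕ ↦ f.2 * f.1.natDegree).sum :=
    lambdaInvariant_eq_sum_natDegree_holds p M hfs' hψ
  obtain ⟨hQ, hdeg⟩ := isDistinguishedAt_prod_pow fs hfs'
  refine ⟨(fs.map fun f : ℤ_[p][X] × ℕ ↦ f.1 ^ f.2).prod, hQ, by rw [hdeg, hlam], ?_⟩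
  rw [hchar, charElement, hμs, pow_zero, map_one, one_mul, coe_prod_pow]

end Structure

/-! ### §3 `λ(M) = n ⟺` any generator of `Ch_Λ(M)·R₀⟦T⟧` has norm profile `n` -/

section Profile

variable (M : Type*) [AddCommGroup M] [Module (IwasawaAlgebra p) M] [Module.Finite (IwasawaAlgebra p) M]

/-- **`λ(M) = n ⟺ profileₙ(g)` for every generator `g` of `Ch_Λ(M)·R₀⟦T⟧`** (`M` finitely generated
torsion with `μ(M) = 0`): `Ch_Λ(M)·R₀⟦T⟧ = (Q)` for the distinguished `Q` of §2, whose profile index is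
`deg Q = λ(M)`; `g` and `Q` generate the same principal ideal of the domain `R₀⟦T⟧`, hence have the same
profile (`normProfile_iff_of_span_singleton_eq`); the index is unique.
[cite: Washington1997, §13.2 and §7.1] [cite: GreenbergVatsal2000, p. 2, (1)–(2)] -/
theorem lambdaInvariant_eq_iff_normProfile (hM : Module.IsTorsion (IwasawaAlgebra p) M)
    (hμ : muInvariant p M = 0) {g : UnrSeries p}
    (hg : (Module.charIdeal (IwasawaAlgebra p) M).map (PowerSeries.map (Halves.toUnr p)) =
      Ideal.span {g}) (n : ℕ) :
    lambdaInvariant p M = n ↔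
      (∀ i < n, ‖((PowerSeries.coeff i g : unrIntegers p) : ℂ_[p])‖ < 1) ∧
        ‖((PowerSeries.coeff n g : unrIntegers p) : ℂ_[p])‖ = 1 := by
  obtain ⟨Q, hQ, hdeg, hchar⟩ := exists_isDistinguishedAt_charIdeal_eq_span M hM hμ
  have hmap : (Module.charIdeal (IwasawaAlgebra p) M).map (PowerSeries.map (Halves.toUnr p)) =
      Ideal.span {PowerSeries.map (Halves.toUnr p) (Q : IwasawaAlgebra p)} := by
    rw [hchar, map_span_singleton_toUnr]
  have hprofQ := normProfile_map_coe_of_isDistinguishedAt hQ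
  rw [hdeg] at hprofQ
  have hiff := normProfile_iff_of_span_singleton_eq (hg.symm.trans hmap) n
  constructor
  · rintro rfl
    exact hiff.mpr hprofQ
  · intro h
    -- the profile index is unique (cf. tree `UniversalToricDescentSelfMuZero.normProfile_unique`)
    have h' := hiff.mp h
    by_contra hne
    rcases Nat.lt_or_gt_of_ne hne with hlt | hgt
    · exact (h'.1 _ hlt).ne hprofQ.2
    · exact (hprofQ.1 _ hgt).ne h'.2

/-- **`μ(M) = 0` ⟹ a generator with norm profile `λ(M)` exists.** [cite: Washington1997, §13.2] -/
theorem exists_generator_normProfile (hM : Module.IsTorsion (IwasawaAlgebra p) M)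
    (hμ : muInvariant p M = 0) :
    ∃ g : UnrSeries p,
      (Module.charIdeal (IwasawaAlgebra p) M).map (PowerSeries.map (Halves.toUnr p)) = Ideal.span {g} ∧
        (∀ i < lambdaInvariant p M, ‖((PowerSeries.coeff i g : unrIntegers p) : ℂ_[p])‖ < 1) ∧
          ‖((PowerSeries.coeff (lambdaInvariant p M) g : unrIntegers p) : ℂ_[p])‖ = 1 := by
  obtain ⟨Q, hQ, hdeg, hchar⟩ := exists_isDistinguishedAt_charIdeal_eq_span M hM hμ
  refine ⟨PowerSeries.map (Halves.toUnr p) (Q : IwasawaAlgebra p), by rw [hchar, map_span_singleton_toUnr],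
    ?_⟩
  rw [← hdeg]
  exact normProfile_map_coe_of_isDistinguishedAt hQ

end Profile

/-! ### §4 Readings for `X_ac^Σ(E[p^∞])` in the route's currency -/

section AcSelmer

variable {K : Type} [Field K] [NumberField K] (W : WeierstrassCurve K) [W.IsElliptic] (p : ℕ)
  [Fact p.Prime] (κ : ZpExtension K p) (𝔭 : HeightOneSpectrum (𝓞 K)) (S : Set (HeightOneSpectrum (𝓞 K)))
  (γ : Field.absoluteGaloisGroup K) [Fact (κ.IsTopGenerator γ)]

/-- **`X_ac^Σ` torsion with `μ = 0` (finite `Σ`) ⟹ `Ch_Λ(X_ac^Σ)·R₀⟦T⟧ = (g)` with `profile_{λ(X)}(g)`** —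
the `∃ g` clause of 21845 / crux #2 with the index PINNED to the intrinsic λ-invariant.
[cite: Washington1997, §13.2] [cite: GreenbergVatsal2000, p. 2, (1)–(2)] -/
theorem exists_generator_normProfile_lambdaInvariant (hS : S.Finite)
    (hT : Module.IsTorsion (IwasawaAlgebra p) (XAc W p κ 𝔭 S γ))
    (hμ : muInvariant p (XAc W p κ 𝔭 S γ) = 0) :
    ∃ g : UnrSeries p,
      (XAc.charIdeal W p κ 𝔭 S γ).map (PowerSeries.map (Halves.toUnr p)) = Ideal.span {g} ∧
        (∀ i < lambdaInvariant p (XAc W p κ 𝔭 S γ),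
          ‖((PowerSeries.coeff i g : unrIntegers p) : ℂ_[p])‖ < 1) ∧
          ‖((PowerSeries.coeff (lambdaInvariant p (XAc W p κ 𝔭 S γ)) g : unrIntegers p) : ℂ_[p])‖ = 1 := by
  haveI := XAc.module_finite κ 𝔭 S γ hS (W := W)
  exact exists_generator_normProfile (XAc W p κ 𝔭 S γ) hT hμ

/-- **Conversely, a generator with profile index `n` pins `λ(X_ac^Σ) = n`** (finite `Σ`, torsion, `μ = 0`).
[cite: Washington1997, §13.2] -/
theorem lambdaInvariant_eq_of_generator_normProfile (hS : S.Finite)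
    (hT : Module.IsTorsion (IwasawaAlgebra p) (XAc W p κ 𝔭 S γ))
    (hμ : muInvariant p (XAc W p κ 𝔭 S γ) = 0) {g : UnrSeries p} {n : ℕ}
    (hg : (XAc.charIdeal W p κ 𝔭 S γ).map (PowerSeries.map (Halves.toUnr p)) = Ideal.span {g})
    (hgn : (∀ i < n, ‖((PowerSeries.coeff i g : unrIntegers p) : ℂ_[p])‖ < 1) ∧
      ‖((PowerSeries.coeff n g : unrIntegers p) : ℂ_[p])‖ = 1) :
    lambdaInvariant p (XAc W p κ 𝔭 S γ) = n := by
  haveI := XAc.module_finite κ 𝔭 S γ hS (W := W)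
  exact (lambdaInvariant_eq_iff_normProfile (XAc W p κ 𝔭 S γ) hT hμ hg n).mpr hgn

/-- **A generator with SOME unit coefficient already gives `μ = 0`, hence a (possibly different-looking)
profile pinned at `λ`**: combining `UniversalToricDescentAcDualMuZero.muInvariant_eq_zero_of_map_charIdeal_eq_span`
with the above — the form in which B′1 (`TorsionMuTransportModThree`) feeds 21845.
[cite: GreenbergVatsal2000, p. 2, (1)–(2)] [cite: Washington1997, §13.2] -/
theorem normProfile_lambdaInvariant_of_exists_unit_coeff (hS : S.Finite)
    (hT : Module.IsTorsion (IwasawaAlgebra p) (XAc W p κ 𝔭 S γ)) {g : UnrSeries p}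
    (hg : (XAc.charIdeal W p κ 𝔭 S γ).map (PowerSeries.map (Halves.toUnr p)) = Ideal.span {g})
    (hi : ∃ i : ℕ, ‖((PowerSeries.coeff i g : unrIntegers p) : ℂ_[p])‖ = 1) :
    (∀ i < lambdaInvariant p (XAc W p κ 𝔭 S γ),
        ‖((PowerSeries.coeff i g : unrIntegers p) : ℂ_[p])‖ < 1) ∧
      ‖((PowerSeries.coeff (lambdaInvariant p (XAc W p κ 𝔭 S γ)) g : unrIntegers p) : ℂ_[p])‖ = 1 := by
  haveI := XAc.module_finite κ 𝔭 S γ hS (W := W)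
  have hμ : muInvariant p (XAc W p κ 𝔭 S γ) = 0 :=
    muInvariant_eq_zero_of_map_charIdeal_eq_span (XAc W p κ 𝔭 S γ) hT hg hi
  exact (lambdaInvariant_eq_iff_normProfile (XAc W p κ 𝔭 S γ) hT hμ hg _).mp rfl

end AcSelmer

end Summit.BirchSwinnertonDyer.BirchSwinnertonDyer.Theorems.UniversalToricDescentLambdaNormProfile

end
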